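import Summits.Ventures.PercRepro.C025ProfilePLDUniformTable_r7_s4_m7
import Summits.Ventures.PercRepro.C025ProfilePLDSolidLiftArithSmall
import Summits.Ventures.PercRepro.C025ProfilePLDSolidTable7n1
import Summits.Ventures.PercRepro.C025ProfilePLDSolidTable7n2

/-!
# (PLD) FOR «M ⊕ U_{4,m}» FOR EVERY m ≥ 7 AND EVERY (PLD)-MATROID M OF RANK ≤ 7: THE CERTIFICATE TABLE FOR U_{4,7} LIFTED IN m (night-3 g32)

`proofs/NIGHT3-G32-MATCHING.md` §6 (g31 §7).  The profile of the solid `U_{4,m}` is `T₀₄ + m·T₁₄ + C(m,2)·T₂₄ + C(m,3)·T₃₄ + c_m·δ₄₄`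
(`PLDSolidLift.sum_choose_min_four`, `m ≥ 7`); `T₃₄` and `δ₄₄` preserve PER-LAYER DOMINANCE (g29), the small joint-LP preservers `q₄ⁿ = T₁₄ + 2·T₂₄ + 3·T₃₄` and
`q₄ⁿ′ = T₂₄ + 2·T₃₄` do at rank ≤ 7 (`PLDPlaneTable.pld_conv_q4n1_of_eRank_le_7`, `pld_conv_q4n2_of_eRank_le_7`), and
`6·(U_{4,7+k} − U_{4,7}) = 6k·q₄ⁿ + 3k(9+k)·q₄ⁿ′ + k(k²+12k+35)·T₃₄ + 6(c_{7+k} − c₇)·δ₄₄` (`PLDSolidLiftSmall.lift_instance_solid_small`): ONE certificate table — the landed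
`uniform_4_7_table_7` for `M ⊕ U_{4,7}` at rank ≤ 7 — gives (PLD) for `M ⊕ U_{4,m}` for EVERY `m ≥ 7`
(`pld_disjointSum_uniform_four_ge_7_of_eRank_le_7`).  No `def`, no `instance`, no notation.  Axioms: standard.
-/

open scoped Matroid

namespace PercRepro

open Finset ThmH

namespace PLDSolidLift

variable {α : Type} [DecidableEq α]

/-- (PLD) FOR «M ⊕ U_{4,m}» FOR EVERY `m ≥ 7` AND EVERY (PLD)-MATROID `M` OF RANK ≤ 7: the uniform matroid is
`truncate (freeOn F) 4` with `|F| = m ≥ 7`. -/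
theorem pld_disjointSum_uniform_four_ge_7_of_eRank_le_7 (M : Matroid α) [M.Finite] (hr : M.eRank ≤ 7)
    (hPLD : ∀ lo hi δ Θ : ℕ, Θ ≤ lo + hi + δ → (lo = 0 ∨ lo + hi + δ ≤ Θ) →
      (∑ I ∈ (gr M).powerset, (if lo ≤ (M.eRk (I : Set α)).toNat ∧ (M.eRk (I : Set α)).toNat ≤ hi ∧
          Θ ≤ (M.eRk ((gr M \ I : Finset α) : Set α)).toNat + (M.eRk (I : Set α)).toNat then
          ((M.eRk ((gr M \ I : Finset α) : Set α)).toNat).choose δ else 0)) ≤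
        ∑ I ∈ (gr M).powerset, (if lo + δ ≤ (M.eRk ((gr M \ I : Finset α) : Set α)).toNat ∧
          (M.eRk ((gr M \ I : Finset α) : Set α)).toNat ≤ hi + δ then
          ((M.eRk ((gr M \ I : Finset α) : Set α)).toNat).choose δ else 0))
    (F : Finset α) (hF : 7 ≤ F.card)
    (h : Disjoint M.E (@Matroid.truncate α (Matroid.freeOn (F : Set α)) (PLDTruncate.freeOn_finite' F) 4).E) :
    haveI := PLDTruncate.freeOn_finite' F
    haveI := PLDClosure.disjointSum_finite' _ _ h
    ∀ lo hi δ Θ : ℕ, Θ ≤ lo + hi + δ → (lo = 0 ∨ lo + hi + δ ≤ Θ) →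
      (∑ I ∈ (gr (M.disjointSum (Matroid.truncate (Matroid.freeOn (F : Set α)) 4) h)).powerset, (if lo ≤ ((M.disjointSum (Matroid.truncate (Matroid.freeOn (F : Set α)) 4) h).eRk (I : Set α)).toNat ∧ ((M.disjointSum (Matroid.truncate (Matroid.freeOn (F : Set α)) 4) h).eRk (I : Set α)).toNat ≤ hi ∧
          Θ ≤ ((M.disjointSum (Matroid.truncate (Matroid.freeOn (F : Set α)) 4) h).eRk ((gr (M.disjointSum (Matroid.truncate (Matroid.freeOn (F : Set α)) 4) h) \ I : Finset α) : Set α)).toNat + ((M.disjointSum (Matroid.truncate (Matroid.freeOn (F : Set α)) 4) h).eRk (I : Set α)).toNat then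
          (((M.disjointSum (Matroid.truncate (Matroid.freeOn (F : Set α)) 4) h).eRk ((gr (M.disjointSum (Matroid.truncate (Matroid.freeOn (F : Set α)) 4) h) \ I : Finset α) : Set α)).toNat).choose δ else 0)) ≤
        ∑ I ∈ (gr (M.disjointSum (Matroid.truncate (Matroid.freeOn (F : Set α)) 4) h)).powerset, (if lo + δ ≤ ((M.disjointSum (Matroid.truncate (Matroid.freeOn (F : Set α)) 4) h).eRk ((gr (M.disjointSum (Matroid.truncate (Matroid.freeOn (F : Set α)) 4) h) \ I : Finset α) : Set α)).toNat ∧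
          ((M.disjointSum (Matroid.truncate (Matroid.freeOn (F : Set α)) 4) h).eRk ((gr (M.disjointSum (Matroid.truncate (Matroid.freeOn (F : Set α)) 4) h) \ I : Finset α) : Set α)).toNat ≤ hi + δ then
          (((M.disjointSum (Matroid.truncate (Matroid.freeOn (F : Set α)) 4) h).eRk ((gr (M.disjointSum (Matroid.truncate (Matroid.freeOn (F : Set α)) 4) h) \ I : Finset α) : Set α)).toNat).choose δ else 0) := by
  haveI := PLDTruncate.freeOn_finite' F
  haveI := PLDClosure.disjointSum_finite' _ _ h
  have hU : (Matroid.truncate (Matroid.freeOn (F : Set α)) 4).eRank ≤ ((4 : ℕ) : ℕ∞) := by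
    rw [Matroid.truncate_eRank]; exact min_le_right _ _
  have hr' : M.eRank ≤ ((7 : ℕ) : ℕ∞) := by exact_mod_cast hr
  have hb : ∀ I ∈ (gr (M.disjointSum (Matroid.truncate (Matroid.freeOn (F : Set α)) 4) h)).powerset,
      ((M.disjointSum (Matroid.truncate (Matroid.freeOn (F : Set α)) 4) h).eRk (I : Set α)).toNat ≤ 11 ∧ ((M.disjointSum (Matroid.truncate (Matroid.freeOn (F : Set α)) 4) h).eRk ((gr (M.disjointSum (Matroid.truncate (Matroid.freeOn (F : Set α)) 4) h) \ I : Finset α) : Set α)).toNat ≤ 11 := by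
    intro I _
    constructor
    · rw [PLDClosure.toNat_eRk_disjointSum]
      have h1 := PLDCert.toNat_eRk_le_of_eRank_le M hr' ((I ∩ gr M : Finset α) : Set α)
      have h2 := PLDCert.toNat_eRk_le_of_eRank_le _ hU ((I ∩ gr (Matroid.truncate (Matroid.freeOn (F : Set α)) 4) : Finset α) : Set α)
      omega
    · rw [PLDClosure.toNat_eRk_disjointSum]
      have h1 := PLDCert.toNat_eRk_le_of_eRank_le M hr' (((gr (M.disjointSum (Matroid.truncate (Matroid.freeOn (F : Set α)) 4) h) \ I) ∩ gr M : Finset α) : Set α)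
      have h2 := PLDCert.toNat_eRk_le_of_eRank_le _ hU (((gr (M.disjointSum (Matroid.truncate (Matroid.freeOn (F : Set α)) 4) h) \ I) ∩ gr (Matroid.truncate (Matroid.freeOn (F : Set α)) 4) : Finset α) : Set α)
      omega
  refine PLDSymCex.pld_of_bounded (gr (M.disjointSum (Matroid.truncate (Matroid.freeOn (F : Set α)) 4) h)).powerset (fun I : Finset α => ((M.disjointSum (Matroid.truncate (Matroid.freeOn (F : Set α)) 4) h).eRk (I : Set α)).toNat)
    (fun I : Finset α => ((M.disjointSum (Matroid.truncate (Matroid.freeOn (F : Set α)) 4) h).eRk ((gr (M.disjointSum (Matroid.truncate (Matroid.freeOn (F : Set α)) 4) h) \ I : Finset α) : Set α)).toNat) 11 hb ?_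
  intro lo hi δ hlh hhR hδR
  have hL := PLDClosure.sum_powerset_disjointSum M _ h
    (fun x f => if lo ≤ x ∧ x ≤ hi ∧ (if lo = 0 then 0 else lo + hi + δ) ≤ f + x then f.choose δ else 0)
  have hR := PLDClosure.sum_powerset_disjointSum M _ h
    (fun x f => if lo + δ ≤ f ∧ f ≤ hi + δ then f.choose δ else 0)
  beta_reduce at hL hR
  rw [hL, hR]
  have h2L : ∀ x₁ f₁ : ℕ,
      ∑ I₂ ∈ (gr (Matroid.truncate (Matroid.freeOn (F : Set α)) 4)).powerset,
        (if lo ≤ x₁ + ((Matroid.truncate (Matroid.freeOn (F : Set α)) 4).eRk (I₂ : Set α)).toNat ∧ x₁ + ((Matroid.truncate (Matroid.freeOn (F : Set α)) 4).eRk (I₂ : Set α)).toNat ≤ hi ∧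
            (if lo = 0 then 0 else lo + hi + δ) ≤ f₁ + ((Matroid.truncate (Matroid.freeOn (F : Set α)) 4).eRk ((gr (Matroid.truncate (Matroid.freeOn (F : Set α)) 4) \ I₂ : Finset α) : Set α)).toNat +
              (x₁ + ((Matroid.truncate (Matroid.freeOn (F : Set α)) 4).eRk (I₂ : Set α)).toNat) then
          (f₁ + ((Matroid.truncate (Matroid.freeOn (F : Set α)) 4).eRk ((gr (Matroid.truncate (Matroid.freeOn (F : Set α)) 4) \ I₂ : Finset α) : Set α)).toNat).choose δ else 0) =
      (∑ i ∈ range (F.card + 1), Nat.choose F.card i * (if lo ≤ x₁ + min i 4 ∧ x₁ + min i 4 ≤ hi ∧ (if lo = 0 then 0 else lo + hi + δ) ≤ (f₁ + min (F.card - i) 4) + (x₁ + min i 4) then (f₁ + min (F.card - i) 4).choose δ else 0)) := by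
    intro x₁ f₁
    have := PLDTruncate.sum_powerset_truncate_freeOn F 4
      (fun x₂ f₂ => if lo ≤ x₁ + x₂ ∧ x₁ + x₂ ≤ hi ∧ (if lo = 0 then 0 else lo + hi + δ) ≤ f₁ + f₂ + (x₁ + x₂) then
        (f₁ + f₂).choose δ else 0)
    beta_reduce at this
    exact this
  have h2R : ∀ f₁ : ℕ,
      ∑ I₂ ∈ (gr (Matroid.truncate (Matroid.freeOn (F : Set α)) 4)).powerset,
        (if lo + δ ≤ f₁ + ((Matroid.truncate (Matroid.freeOn (F : Set α)) 4).eRk ((gr (Matroid.truncate (Matroid.freeOn (F : Set α)) 4) \ I₂ : Finset α) : Set α)).toNat ∧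
            f₁ + ((Matroid.truncate (Matroid.freeOn (F : Set α)) 4).eRk ((gr (Matroid.truncate (Matroid.freeOn (F : Set α)) 4) \ I₂ : Finset α) : Set α)).toNat ≤ hi + δ then
          (f₁ + ((Matroid.truncate (Matroid.freeOn (F : Set α)) 4).eRk ((gr (Matroid.truncate (Matroid.freeOn (F : Set α)) 4) \ I₂ : Finset α) : Set α)).toNat).choose δ else 0) =
      (∑ i ∈ range (F.card + 1), Nat.choose F.card i * (if lo + δ ≤ f₁ + min (F.card - i) 4 ∧ f₁ + min (F.card - i) 4 ≤ hi + δ then (f₁ + min (F.card - i) 4).choose δ else 0)) := by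
    intro f₁
    have := PLDTruncate.sum_powerset_truncate_freeOn F 4
      (fun x₂ f₂ => if lo + δ ≤ f₁ + f₂ ∧ f₁ + f₂ ≤ hi + δ then (f₁ + f₂).choose δ else 0)
    beta_reduce at this
    exact this
  simp only [h2L, h2R]
  -- the case `m = 7` from the landed table, in two δ-parts
  have h4 : ∑ I ∈ (gr M).powerset, (∑ i ∈ range (7 + 1), Nat.choose 7 i * (if lo ≤ (M.eRk (I : Set α)).toNat + min i 4 ∧ (M.eRk (I : Set α)).toNat + min i 4 ≤ hi ∧ (if lo = 0 then 0 else lo + hi + δ) ≤ ((M.eRk ((gr M \ I : Finset α) : Set α)).toNat + min (7 - i) 4) + ((M.eRk (I : Set α)).toNat + min i 4) then ((M.eRk ((gr M \ I : Finset α) : Set α)).toNat + min (7 - i) 4).choose δ else 0)) ≤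
      ∑ I ∈ (gr M).powerset, (∑ i ∈ range (7 + 1), Nat.choose 7 i * (if lo + δ ≤ (M.eRk ((gr M \ I : Finset α) : Set α)).toNat + min (7 - i) 4 ∧ (M.eRk ((gr M \ I : Finset α) : Set α)).toNat + min (7 - i) 4 ≤ hi + δ then ((M.eRk ((gr M \ I : Finset α) : Set α)).toNat + min (7 - i) 4).choose δ else 0)) := by
    rcases Nat.lt_or_ge δ 6 with hδ0 | hδ0
    · obtain ⟨hDpos, hadm, hcert⟩ := PLDTriangle.uniform_4_7_table_7_part0 _ rfl lo (mem_range.2 (by omega)) hi (mem_range.2 (by omega))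
        δ (mem_range.2 (by omega)) hlh
      have key := PLDCert.sum_le_of_cert M hPLD 7 hr' _ hadm _ _ hcert
      rw [← Finset.mul_sum, ← Finset.mul_sum] at key
      exact Nat.le_of_mul_le_mul_left key hDpos
    obtain ⟨hDpos, hadm, hcert⟩ := PLDTriangle.uniform_4_7_table_7_part1 _ rfl lo (mem_range.2 (by omega)) hi (mem_range.2 (by omega))
      δ (mem_Ico.2 ⟨by omega, by omega⟩) hlh
    have key := PLDCert.sum_le_of_cert M hPLD 7 hr' _ hadm _ _ hcert
    rw [← Finset.mul_sum, ← Finset.mul_sum] at key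
    exact Nat.le_of_mul_le_mul_left key hDpos
  -- the lift to `m = |F| ≥ 7`
  have hq := PLDPlaneTable.pld_conv_q4n1_of_eRank_le_7 M hr hPLD lo hi δ hlh hhR hδR
  have hq' := PLDPlaneTable.pld_conv_q4n2_of_eRank_le_7 M hr hPLD lo hi δ hlh hhR hδR
  exact PLDSolidLiftSmall.lift_instance_solid_small (gr M).powerset (fun I : Finset α => (M.eRk (I : Set α)).toNat)
    (fun I : Finset α => (M.eRk ((gr M \ I : Finset α) : Set α)).toNat) hPLD F.card hF lo hi δ
    (if lo = 0 then 0 else lo + hi + δ) (by split_ifs <;> omega) (by split_ifs <;> omega)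
    (by simpa only [mul_add, add_assoc, one_mul] using hq) (by simpa only [mul_add, add_assoc, one_mul] using hq') h4

end PLDSolidLift

end PercRepro
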